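import Summits.AtomisticToContinuum.BoseEinsteinCondensation.Theorems.BECRieszReverseHolderCoarseGrainedReverseHolderStubRieszShadowFieldMomentThetaLeOne

/-!
# The wall of `RieszShadowFieldMoment`, certified: impurity mean-field bound ⇒ the item for `θ ≤ 4`

Line `registered` of crux stmt-AtomisticToContinuum-12840 (route BECRieszReverseHolder); registered
sub-goal `rieszShadowFieldMoment_of_impurityMeanField` of the stub `stub_rieszShadowFieldMoment`
(= route item stmt-AtomisticToContinuum-12841 `RieszShadowFieldMoment`). CONDITIONAL: closes nothing;
it kernel-checks that the open content of the item beyond the proved slice `θ ≤ 1`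
(`stub_rieszShadowFieldMoment_thetaLeOne`) is exactly the following classical estimate.

**Impurity mean-field bound (IMF).** In the Kac / weak-coupling corner (`ρη³ ≥ 1`, `bρ^{2/3} ≤ Γ₁`),
for the item's kernel `g`, Hamiltonian `H = Σ_{i<j} g(X_i - X_j)`, cavity field
`h_X(y) = Σ_j g(y - X_j)`, every pin `y` and the charges `m = 2, 3, 4`:

  `-c ∫_{cell^n} e^{-bH - m b h_y} ≤ ∫_{cell^n} (b h_y) e^{-bH - m b h_y}`,  `c < 1` uniform,

i.e. the mean cavity field at a charge-`m` impurity sitting at `y`, under the Gibbs measure tilted by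
that impurity, is `≥ -c/b` uniformly in `n, L`. For `m = 1` (an impurity identical to the bath
particles) this is the relabelling-symmetry + Onsager inequality of the engine
(`stub_rieszFieldMomentPinned`, `c = b g(0) ≤ 1/2`); for `m ≥ 2` symmetry is lost and IMF is a
one-point local law of the high-temperature, long-range periodic Riesz-2 gas (not in print for this
regime: Peilen–Serfaty 2025 treat confined gases at `β ≥ 1`).

**Reduction** (`RieszFieldMoment.theta_le_four`). With `A(θ) = ∫ e^{-bH - θ b h_y}`:
`A(m-1) = ∫ e^{-bH - m b h_y} e^{b h_y} ≥ ∫ e^{-bH - m b h_y}(1 + b h_y) ≥ (1 - c) A(m)`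
(`RieszFieldMoment.step_of_meanField`), so `A(1) ≤ 2A(0)` (engine) and `A(m) ≤ A(m-1)/(1-c)`,
`m = 2,3,4`; and `θ ↦ e^{-θ b h}` is convex, so `A(θ) ≤ (m-θ)A(m-1) + (θ-m+1)A(m)` on `[m-1, m]`
(`RieszFieldMoment.interp`). Hence `A(θ) ≤ 2(1-c)⁻³ A(0)` on `[0, 4]`: the item with
`Γ₀ = min(Γ₀^{corner}, Γ₁)`, `C = 2/(1 - max(c,0))³`.
-/

namespace Summit.AtomisticToContinuum.BoseEinsteinCondensation.Theorems.CoarseGrainedReverseHolder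

open Summit.AtomisticToContinuum.BoseEinsteinCondensation.Theses.BECRieszReverseHolder
open MeasureTheory Real
open Literature.MathematicalPhysics.StatisticalMechanics Literature.Analysis.UnboundedOperators
open Literature.MathematicalPhysics.QuantumManyBody BoseGas


/-! ## The wall, certified: the impurity mean-field bound implies the item for `θ ≤ 4` -/

namespace RieszFieldMoment

variable {n : ℕ} {L : ℝ}

/-- **One charge step.** If the mean cavity field at a charge-`m` impurity is at least `-c`
(`-c ∫ e^{-E - m h_y} ≤ ∫ h_y e^{-E - m h_y}`), then `(1 - c) ∫ e^{-E - m h_y} ≤ ∫ e^{-E - (m-1) h_y}`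
(`e^{h} ≥ 1 + h`). -/
theorem step_of_meanField (u : Space → ℝ) (hu : Continuous u) (m c : ℝ) (y : Space)
    (hmf : -(c * ∫ X in cellN n L, Real.exp (-(∑ a : Fin n, ∑ c : Fin n with a < c, u (X a - X c)) -
        m * ∑ j : Fin n, u (y - X j))) ≤
      ∫ X in cellN n L, (∑ j : Fin n, u (y - X j)) *
        Real.exp (-(∑ a : Fin n, ∑ c : Fin n with a < c, u (X a - X c)) - m * ∑ j : Fin n, u (y - X j))) :
    (1 - c) * ∫ X in cellN n L, Real.exp (-(∑ a : Fin n, ∑ c : Fin n with a < c, u (X a - X c)) -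
        m * ∑ j : Fin n, u (y - X j)) ≤
      ∫ X in cellN n L, Real.exp (-(∑ a : Fin n, ∑ c : Fin n with a < c, u (X a - X c)) -
        (m - 1) * ∑ j : Fin n, u (y - X j)) := by
  have hEc : Continuous fun X : Config n => ∑ a : Fin n, ∑ c : Fin n with a < c, u (X a - X c) :=
    continuous_finsetSum _ fun a _ => continuous_finsetSum _ fun c _ =>
      hu.comp ((continuous_apply a).sub (continuous_apply c))
  have hhc : Continuous fun X : Config n => ∑ j : Fin n, u (y - X j) :=
    continuous_finsetSum _ fun j _ => hu.comp (continuous_const.sub (continuous_apply j))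
  have hmc : Continuous fun X : Config n => Real.exp (-(∑ a : Fin n, ∑ c : Fin n with a < c,
      u (X a - X c)) - m * ∑ j : Fin n, u (y - X j)) :=
    Real.continuous_exp.comp (hEc.neg.sub (continuous_const.mul hhc))
  have hm1c : Continuous fun X : Config n => Real.exp (-(∑ a : Fin n, ∑ c : Fin n with a < c,
      u (X a - X c)) - (m - 1) * ∑ j : Fin n, u (y - X j)) :=
    Real.continuous_exp.comp (hEc.neg.sub (continuous_const.mul hhc))
  have hi1 : IntegrableOn (fun X : Config n => Real.exp (-(∑ a : Fin n, ∑ c : Fin n with a < c,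
      u (X a - X c)) - m * ∑ j : Fin n, u (y - X j))) (cellN n L) volume := integrableOn_cellN hmc L
  have hi2 : IntegrableOn (fun X : Config n => (∑ j : Fin n, u (y - X j)) *
      Real.exp (-(∑ a : Fin n, ∑ c : Fin n with a < c, u (X a - X c)) - m * ∑ j : Fin n, u (y - X j)))
      (cellN n L) volume := integrableOn_cellN (hhc.mul hmc) L
  have hpt : ∀ X : Config n,
      Real.exp (-(∑ a : Fin n, ∑ c : Fin n with a < c, u (X a - X c)) - m * ∑ j : Fin n, u (y - X j)) +
        (∑ j : Fin n, u (y - X j)) *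
          Real.exp (-(∑ a : Fin n, ∑ c : Fin n with a < c, u (X a - X c)) - m * ∑ j : Fin n, u (y - X j)) ≤
      Real.exp (-(∑ a : Fin n, ∑ c : Fin n with a < c, u (X a - X c)) -
        (m - 1) * ∑ j : Fin n, u (y - X j)) := by
    intro X
    set E := ∑ a : Fin n, ∑ c : Fin n with a < c, u (X a - X c)
    set h := ∑ j : Fin n, u (y - X j)
    have h1 : Real.exp (-E - m * h) + h * Real.exp (-E - m * h) = (h + 1) * Real.exp (-E - m * h) := by
      ring
    rw [h1, show Real.exp (-E - (m - 1) * h) = Real.exp h * Real.exp (-E - m * h) by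
      rw [← Real.exp_add]; ring_nf]
    exact mul_le_mul_of_nonneg_right (Real.add_one_le_exp h) (Real.exp_pos _).le
  have hint : ∫ X in cellN n L, (Real.exp (-(∑ a : Fin n, ∑ c : Fin n with a < c, u (X a - X c)) -
        m * ∑ j : Fin n, u (y - X j)) + (∑ j : Fin n, u (y - X j)) *
          Real.exp (-(∑ a : Fin n, ∑ c : Fin n with a < c, u (X a - X c)) - m * ∑ j : Fin n, u (y - X j))) ≤
      ∫ X in cellN n L, Real.exp (-(∑ a : Fin n, ∑ c : Fin n with a < c, u (X a - X c)) -
        (m - 1) * ∑ j : Fin n, u (y - X j)) :=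
    setIntegral_mono_on (hi1.add hi2) (integrableOn_cellN hm1c L) (measurableSet_cellN n L)
      fun X _ => hpt X
  rw [integral_add hi1 hi2] at hint
  linarith

/-- **Interpolation between consecutive charges** (convexity of `exp`): for `θ ∈ [m-1, m]`,
`∫ e^{-E - θ h} ≤ (m - θ) ∫ e^{-E - (m-1) h} + (θ - m + 1) ∫ e^{-E - m h}`. -/
theorem interp (u : Space → ℝ) (hu : Continuous u) (m : ℝ) {θ : ℝ} (h0 : m - 1 ≤ θ) (h1 : θ ≤ m)
    (y : Space) :
    ∫ X in cellN n L, Real.exp (-(∑ a : Fin n, ∑ c : Fin n with a < c, u (X a - X c)) -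
        θ * ∑ j : Fin n, u (y - X j)) ≤
      (m - θ) * (∫ X in cellN n L, Real.exp (-(∑ a : Fin n, ∑ c : Fin n with a < c, u (X a - X c)) -
          (m - 1) * ∑ j : Fin n, u (y - X j))) +
        (θ - (m - 1)) * (∫ X in cellN n L, Real.exp (-(∑ a : Fin n, ∑ c : Fin n with a < c,
          u (X a - X c)) - m * ∑ j : Fin n, u (y - X j))) := by
  have hEc : Continuous fun X : Config n => ∑ a : Fin n, ∑ c : Fin n with a < c, u (X a - X c) :=
    continuous_finsetSum _ fun a _ => continuous_finsetSum _ fun c _ =>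
      hu.comp ((continuous_apply a).sub (continuous_apply c))
  have hhc : Continuous fun X : Config n => ∑ j : Fin n, u (y - X j) :=
    continuous_finsetSum _ fun j _ => hu.comp (continuous_const.sub (continuous_apply j))
  have hc : ∀ k : ℝ, Continuous fun X : Config n => Real.exp (-(∑ a : Fin n, ∑ c : Fin n with a < c,
      u (X a - X c)) - k * ∑ j : Fin n, u (y - X j)) := fun k =>
    Real.continuous_exp.comp (hEc.neg.sub (continuous_const.mul hhc))
  have hpt : ∀ X : Config n,
      Real.exp (-(∑ a : Fin n, ∑ c : Fin n with a < c, u (X a - X c)) - θ * ∑ j : Fin n, u (y - X j)) ≤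
      (m - θ) * Real.exp (-(∑ a : Fin n, ∑ c : Fin n with a < c, u (X a - X c)) -
          (m - 1) * ∑ j : Fin n, u (y - X j)) +
        (θ - (m - 1)) * Real.exp (-(∑ a : Fin n, ∑ c : Fin n with a < c, u (X a - X c)) -
          m * ∑ j : Fin n, u (y - X j)) := by
    intro X
    set E := ∑ a : Fin n, ∑ c : Fin n with a < c, u (X a - X c)
    set h := ∑ j : Fin n, u (y - X j)
    have key := convexOn_exp.2 (Set.mem_univ (-E - (m - 1) * h)) (Set.mem_univ (-E - m * h))
      (sub_nonneg.2 h1) (sub_nonneg.2 h0) (by ring)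
    simp only [smul_eq_mul] at key
    have harg : (m - θ) * (-E - (m - 1) * h) + (θ - (m - 1)) * (-E - m * h) = -E - θ * h := by ring
    rw [harg] at key
    exact key
  have i1 : IntegrableOn (fun X : Config n => (m - θ) * Real.exp (-(∑ a : Fin n, ∑ c : Fin n with a < c,
      u (X a - X c)) - (m - 1) * ∑ j : Fin n, u (y - X j))) (cellN n L) volume :=
    integrableOn_cellN (continuous_const.mul (hc _)) L
  have i2 : IntegrableOn (fun X : Config n => (θ - (m - 1)) * Real.exp (-(∑ a : Fin n, ∑ c : Fin n
      with a < c, u (X a - X c)) - m * ∑ j : Fin n, u (y - X j))) (cellN n L) volume :=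
    integrableOn_cellN (continuous_const.mul (hc _)) L
  have hint : ∫ X in cellN n L, Real.exp (-(∑ a : Fin n, ∑ c : Fin n with a < c, u (X a - X c)) -
        θ * ∑ j : Fin n, u (y - X j)) ≤
      ∫ X in cellN n L, ((m - θ) * Real.exp (-(∑ a : Fin n, ∑ c : Fin n with a < c, u (X a - X c)) -
          (m - 1) * ∑ j : Fin n, u (y - X j)) +
        (θ - (m - 1)) * Real.exp (-(∑ a : Fin n, ∑ c : Fin n with a < c, u (X a - X c)) -
          m * ∑ j : Fin n, u (y - X j))) :=
    setIntegral_mono_on (integrableOn_cellN (hc θ) L) (i1.add i2) (measurableSet_cellN n L)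
      fun X _ => hpt X
  rw [integral_add i1 i2, integral_const_mul, integral_const_mul] at hint
  exact hint

/-- **`θ ≤ 4` from the impurity mean-field bound at charges `2, 3, 4`.** For `u` as in the engine with
`u 0 ≤ 1/2`, if for `m = 2, 3, 4` and every pin the mean cavity field at a charge-`m` impurity is at
least `-c` (`0 ≤ c < 1`), then `∫ e^{-E - θ h_y} ≤ 2 (1-c)⁻³ ∫ e^{-E}` for all `θ ∈ [0, 4]`. -/
theorem theta_le_four (hL : 0 < L) (u : Space → ℝ) (hu : Continuous u) (heven : ∀ z, u (-z) = u z)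
    (hper : ∀ (z : Space) (k : Fin 3), u (z + EuclideanSpace.single k L) = u z)
    (hons : ∀ (N : ℕ) (X : Config N), -((N : ℝ) * u 0 / 2) ≤
      ∑ i : Fin N, ∑ j : Fin N with i < j, u (X i - X j))
    (hu0 : u 0 ≤ 1 / 2) {c : ℝ} (hc0 : 0 ≤ c) (hc1 : c < 1) (y : Space)
    (hmf : ∀ m : ℕ, 2 ≤ m → m ≤ 4 →
      -(c * ∫ X in cellN n L, Real.exp (-(∑ a : Fin n, ∑ c : Fin n with a < c, u (X a - X c)) -
        (m : ℝ) * ∑ j : Fin n, u (y - X j))) ≤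
      ∫ X in cellN n L, (∑ j : Fin n, u (y - X j)) *
        Real.exp (-(∑ a : Fin n, ∑ c : Fin n with a < c, u (X a - X c)) - (m : ℝ) * ∑ j : Fin n, u (y - X j)))
    {θ : ℝ} (hθ0 : 0 ≤ θ) (hθ4 : θ ≤ 4) :
    ∫ X in cellN n L, Real.exp (-(∑ a : Fin n, ∑ c : Fin n with a < c, u (X a - X c)) -
        θ * ∑ j : Fin n, u (y - X j)) ≤
      2 / (1 - c) ^ 3 * ∫ X in cellN n L, Real.exp (-(∑ a : Fin n, ∑ c : Fin n with a < c, u (X a - X c))) := by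
  -- `A k = ∫ e^{-E - k h}`
  set A : ℝ → ℝ := fun k => ∫ X in cellN n L, Real.exp (-(∑ a : Fin n, ∑ c : Fin n with a < c,
    u (X a - X c)) - k * ∑ j : Fin n, u (y - X j)) with hA
  set Z : ℝ := ∫ X in cellN n L, Real.exp (-(∑ a : Fin n, ∑ c : Fin n with a < c, u (X a - X c))) with hZ
  have hA0 : A 0 = Z := by
    simp only [hA, hZ, zero_mul, sub_zero]
  have hAnn : ∀ k, 0 ≤ A k := fun k =>
    setIntegral_nonneg (measurableSet_cellN n L) fun X _ => (Real.exp_pos _).le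
  have hZ0 : 0 ≤ Z := hA0 ▸ hAnn 0
  have h1c : 0 < 1 - c := by linarith
  -- `A 1 ≤ 2 Z`
  have hA1 : A 1 ≤ 2 * Z := by
    have h := pinned_le (n := n) hL u hu heven hper hons y
    have h' : (1 - u 0) * A 1 ≤ Z := by simpa only [hA, one_mul] using h
    nlinarith [mul_le_mul_of_nonneg_right hu0 (hAnn 1)]
  -- the three impurity steps
  have hstep : ∀ m : ℕ, 2 ≤ m → m ≤ 4 → (1 - c) * A m ≤ A ((m : ℝ) - 1) := fun m hm2 hm4 =>
    step_of_meanField u hu (m : ℝ) c y (hmf m hm2 hm4)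
  have hA2 : A 2 ≤ 2 * Z / (1 - c) := by
    rw [le_div_iff₀ h1c]
    have h := hstep 2 le_rfl (by norm_num)
    norm_num at h
    linarith
  have hA3 : A 3 ≤ 2 * Z / (1 - c) ^ 2 := by
    rw [le_div_iff₀ (by positivity)]
    have h := hstep 3 (by norm_num) (by norm_num)
    norm_num at h
    have : A 2 * (1 - c) ≤ 2 * Z := (le_div_iff₀ h1c).1 hA2
    nlinarith
  have hA4 : A 4 ≤ 2 * Z / (1 - c) ^ 3 := by
    rw [le_div_iff₀ (by positivity)]
    have h := hstep 4 (by norm_num) le_rfl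
    norm_num at h
    have : A 3 * (1 - c) ^ 2 ≤ 2 * Z := (le_div_iff₀ (by positivity)).1 hA3
    nlinarith
  -- all integer charges are below `K Z`, `K = 2/(1-c)³`
  set K : ℝ := 2 / (1 - c) ^ 3 with hK
  have hinv : 1 ≤ 1 / (1 - c) := by rw [le_div_iff₀ h1c]; linarith
  have hK2 : 2 ≤ K := by
    have : (1 - c) ^ 3 ≤ 1 := by nlinarith
    rw [hK, le_div_iff₀ (by positivity)]
    nlinarith
  have hK1 : 2 * Z / (1 - c) ≤ K * Z := by
    rw [hK, div_mul_eq_mul_div, div_le_div_iff₀ h1c (by positivity)]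
    have : (1 - c) ^ 3 ≤ (1 - c) := by nlinarith
    nlinarith
  have hK2' : 2 * Z / (1 - c) ^ 2 ≤ K * Z := by
    rw [hK, div_mul_eq_mul_div, div_le_div_iff₀ (by positivity) (by positivity)]
    have : (1 - c) ^ 3 ≤ (1 - c) ^ 2 := by nlinarith
    nlinarith
  have hB0 : A 0 ≤ K * Z := by rw [hA0]; nlinarith
  have hB1 : A 1 ≤ K * Z := by nlinarith
  have hB2 : A 2 ≤ K * Z := hA2.trans hK1
  have hB3 : A 3 ≤ K * Z := hA3.trans hK2'
  have hB4 : A 4 ≤ K * Z := by rw [hK, div_mul_eq_mul_div]; simpa [mul_comm] using hA4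
  -- interpolate
  have hgoal : A θ ≤ K * Z := by
    rcases le_or_gt θ 1 with hθ1 | hθ1
    · have h := interp (n := n) (L := L) u hu 1 (by linarith) hθ1 y
      norm_num at h
      calc A θ ≤ (1 - θ) * A 0 + θ * A 1 := by simpa only [hA, zero_mul, sub_zero, one_mul] using h
        _ ≤ (1 - θ) * (K * Z) + θ * (K * Z) := by gcongr
        _ = K * Z := by ring
    rcases le_or_gt θ 2 with hθ2 | hθ2
    · have h := interp (n := n) (L := L) u hu 2 (by linarith) hθ2 y
      norm_num at h
      calc A θ ≤ (2 - θ) * A 1 + (θ - 1) * A 2 := by simpa only [hA, one_mul] using h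
        _ ≤ (2 - θ) * (K * Z) + (θ - 1) * (K * Z) := by gcongr
        _ = K * Z := by ring
    rcases le_or_gt θ 3 with hθ3 | hθ3
    · have h := interp (n := n) (L := L) u hu 3 (by linarith) hθ3 y
      norm_num at h
      calc A θ ≤ (3 - θ) * A 2 + (θ - 2) * A 3 := by simpa only [hA] using h
        _ ≤ (3 - θ) * (K * Z) + (θ - 2) * (K * Z) := by gcongr
        _ = K * Z := by ring
    · have h := interp (n := n) (L := L) u hu 4 (by linarith) hθ4 y
      norm_num at h
      calc A θ ≤ (4 - θ) * A 3 + (θ - 3) * A 4 := by simpa only [hA] using h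
        _ ≤ (4 - θ) * (K * Z) + (θ - 3) * (K * Z) := by gcongr
        _ = K * Z := by ring
  simpa only [hA, hK] using hgoal

end RieszFieldMoment

/-! ## The registered reduction: impurity mean-field bound ⇒ `RieszShadowFieldMoment` -/

/-- **The wall, certified.** Route item stmt-AtomisticToContinuum-12841 `RieszShadowFieldMoment`
(`θ ∈ [0, 4]`) follows from the *impurity mean-field bound* at charges `m = 2, 3, 4`: in the Kac /
weak-coupling corner, for the item's kernel `g`, Hamiltonian `H` and every pin `y`,
`-c ∫ e^{-bH - m b h_y} ≤ ∫ (b h_y) e^{-bH - m b h_y}` with `c < 1` uniform (the mean cavity field at a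
charge-`m` impurity is `≥ -c/b`). The charge-`1` case is the proved engine; `θ ↦ ∫ e^{-bH - θ b h_y}` is
log-convex, so the integer charges control `[0, 4]`. -/
theorem rieszShadowFieldMoment_of_impurityMeanField : (∃ Γ₁ : ℝ, 0 < Γ₁ ∧ ∃ c : ℝ, c < 1 ∧ ∀ (m n : ℕ) (L b η : ℝ), 2 ≤ m → m ≤ 4 → 0 < L → 0 < b → 0 < η → η ≤ L → (1 : ℝ) ≤ (n : ℝ) / L ^ 3 * η ^ 3 → b * ((n : ℝ) / L ^ 3) ^ (2 / 3 : ℝ) ≤ Γ₁ → ∀ g : BoseGas.Space → ℝ, g = (fun x => 2 * Real.pi ^ (3 / 2 : ℝ) * ∫ t in Set.Ioi (η ^ 2), t ^ (-(1 / 2 : ℝ)) * ((∑' mm : Fin 3 → ℤ, Literature.Analysis.UnboundedOperators.heatKernel t (x - BoseGas.latticeVec L mm)) - 1 / L ^ 3)) → ∀ H : BoseGas.Config n → ℝ, H = (fun X => ∑ i : Fin n, ∑ j : Fin n with i < j, g (X i - X j)) → ∀ y : BoseGas.Space, -(c * ∫ X in BoseGas.cellN n L, Real.exp (-(b * H X)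 - (m : ℝ) * b * ∑ j : Fin n, g (y - X j))) ≤ ∫ X in BoseGas.cellN n L, (b * ∑ j : Fin n, g (y - X j)) * Real.exp (-(b * H X) - (m : ℝ) * b * ∑ j : Fin n, g (y - X j))) → RieszShadowFieldMoment := by
  rintro ⟨Γ₁, hΓ₁, c, hc1, hIMF⟩
  obtain ⟨Γ₀, hΓ₀, hcorner⟩ := RieszFieldMoment.corner
  set c' : ℝ := max c 0 with hc'
  have hc'0 : 0 ≤ c' := le_max_right _ _
  have hc'1 : c' < 1 := max_lt hc1 one_pos
  unfold RieszShadowFieldMoment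
  refine ⟨min Γ₀ Γ₁, lt_min hΓ₀ hΓ₁, 2 / (1 - c') ^ 3, ?_⟩
  intro n L b η θ hL hb hη hηL hθ0 hθ4 hkac hΓ g hg H hH y
  have hΓ0' : b * ((n : ℝ) / L ^ 3) ^ (2 / 3 : ℝ) ≤ Γ₀ := hΓ.trans (min_le_left _ _)
  have hΓ1' : b * ((n : ℝ) / L ^ 3) ^ (2 / 3 : ℝ) ≤ Γ₁ := hΓ.trans (min_le_right _ _)
  have hg' : g = periodicRieszKernel 2 L η := by rw [hg, CoarseRH2.periodicRieszKernel_two_eq]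
  subst hH
  have hηne : η ≠ 0 := hη.ne'
  set u : Space → ℝ := fun z => b * g z with hu_def
  have hu : Continuous u := by
    rw [hu_def, hg']
    exact continuous_const.mul (continuous_periodicRieszKernel 2 hL hηne)
  have heven : ∀ z, u (-z) = u z := fun z => by
    simp only [hu_def, hg', periodicRieszKernel_neg]
  have hper : ∀ (z : Space) (k : Fin 3), u (z + EuclideanSpace.single k L) = u z := fun z k => by
    simp only [hu_def, hg', periodicRieszKernel_add_single]
  have hons : ∀ (N : ℕ) (X : Config N), -((N : ℝ) * u 0 / 2) ≤
      ∑ i : Fin N, ∑ j : Fin N with i < j, u (X i - X j) := by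
    intro N X
    have h := mul_le_mul_of_nonneg_left
      (stub_rieszKernelOnsagerBound 2 L η two_pos hL hηne N X) hb.le
    rw [Finset.mul_sum] at h
    simp only [Finset.mul_sum] at h
    simp only [hu_def, hg']
    linarith
  have hu0 : u 0 ≤ 1 / 2 := by
    simp only [hu_def, hg']
    exact hcorner n L b η hL hb hη hkac hΓ0'
  -- the impurity hypothesis in `u`-form, with `c' = max c 0`
  have e3 : ∀ (m : ℕ) (X : Config n), -(b * ∑ i : Fin n, ∑ j : Fin n with i < j, g (X i - X j)) -
      (m : ℝ) * b * ∑ j : Fin n, g (y - X j) =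
      -(∑ i : Fin n, ∑ j : Fin n with i < j, u (X i - X j)) - (m : ℝ) * ∑ j : Fin n, u (y - X j) := by
    intro m X
    simp only [hu_def, Finset.mul_sum]
    ring
  have e4 : ∀ X : Config n, b * ∑ j : Fin n, g (y - X j) = ∑ j : Fin n, u (y - X j) := by
    intro X
    simp only [hu_def, Finset.mul_sum]
  have hmf : ∀ m : ℕ, 2 ≤ m → m ≤ 4 →
      -(c' * ∫ X in cellN n L, Real.exp (-(∑ a : Fin n, ∑ c : Fin n with a < c, u (X a - X c)) -
        (m : ℝ) * ∑ j : Fin n, u (y - X j))) ≤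
      ∫ X in cellN n L, (∑ j : Fin n, u (y - X j)) *
        Real.exp (-(∑ a : Fin n, ∑ c : Fin n with a < c, u (X a - X c)) -
          (m : ℝ) * ∑ j : Fin n, u (y - X j)) := by
    intro m hm2 hm4
    have h := hIMF m n L b η hm2 hm4 hL hb hη hηL hkac hΓ1' g hg _ rfl y
    simp_rw [e3 m, e4] at h
    have hA : 0 ≤ ∫ X in cellN n L, Real.exp (-(∑ a : Fin n, ∑ c : Fin n with a < c, u (X a - X c)) -
        (m : ℝ) * ∑ j : Fin n, u (y - X j)) :=
      setIntegral_nonneg (measurableSet_cellN n L) fun X _ => (Real.exp_pos _).le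
    have hcc : c ≤ c' := le_max_left _ _
    calc -(c' * ∫ X in cellN n L, Real.exp (-(∑ a : Fin n, ∑ c : Fin n with a < c, u (X a - X c)) -
          (m : ℝ) * ∑ j : Fin n, u (y - X j)))
        ≤ -(c * ∫ X in cellN n L, Real.exp (-(∑ a : Fin n, ∑ c : Fin n with a < c, u (X a - X c)) -
          (m : ℝ) * ∑ j : Fin n, u (y - X j))) := by nlinarith [mul_le_mul_of_nonneg_right hcc hA]
      _ ≤ _ := h
  have key := RieszFieldMoment.theta_le_four (n := n) hL u hu heven hper hons hu0 hc'0 hc'1 y hmf hθ0 hθ4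
  -- back to the item's `ℝ≥0∞` form
  have hEc : Continuous fun X : Config n => ∑ a : Fin n, ∑ c : Fin n with a < c, u (X a - X c) :=
    continuous_finsetSum _ fun a _ => continuous_finsetSum _ fun c _ =>
      hu.comp ((continuous_apply a).sub (continuous_apply c))
  have hhc : Continuous fun X : Config n => ∑ j : Fin n, u (y - X j) :=
    continuous_finsetSum _ fun j _ => hu.comp (continuous_const.sub (continuous_apply j))
  have hZc : Continuous fun X : Config n =>
      Real.exp (-(∑ a : Fin n, ∑ c : Fin n with a < c, u (X a - X c))) := Real.continuous_exp.comp hEc.neg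
  have hθc : Continuous fun X : Config n => Real.exp (-(∑ a : Fin n, ∑ c : Fin n with a < c,
      u (X a - X c)) - θ * ∑ j : Fin n, u (y - X j)) :=
    Real.continuous_exp.comp (hEc.neg.sub (continuous_const.mul hhc))
  have e1 : ∀ X : Config n, -(b * ∑ i : Fin n, ∑ j : Fin n with i < j, g (X i - X j)) -
      θ * b * ∑ j : Fin n, g (y - X j) =
      -(∑ i : Fin n, ∑ j : Fin n with i < j, u (X i - X j)) - θ * ∑ j : Fin n, u (y - X j) := by
    intro X
    simp only [hu_def, Finset.mul_sum]
    ring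
  have e2 : ∀ X : Config n, -(b * ∑ i : Fin n, ∑ j : Fin n with i < j, g (X i - X j)) =
      -(∑ i : Fin n, ∑ j : Fin n with i < j, u (X i - X j)) := by
    intro X
    simp only [hu_def, Finset.mul_sum]
  simp_rw [e1, e2]
  rw [← ofReal_integral_eq_lintegral_ofReal (integrableOn_cellN hθc L)
      (Filter.Eventually.of_forall fun X => (Real.exp_pos _).le),
    ← ofReal_integral_eq_lintegral_ofReal (integrableOn_cellN hZc L)
      (Filter.Eventually.of_forall fun X => (Real.exp_pos _).le),
    ← ENNReal.ofReal_mul (by positivity)]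
  exact ENNReal.ofReal_le_ofReal key

end Summit.AtomisticToContinuum.BoseEinsteinCondensation.Theorems.CoarseGrainedReverseHolder
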